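import Literature.Algebra.EuclideanLattices.RegevRoutineLayout
import Literature.Computability.QuantumComplexity.ZoneGadgets
import HarnessLib

/-!
# Regev's per-copy routine as a circuit family, II: the reversible programs

Second file of the circuit-level construction towards `usvp_of_dihedralCoset` (parameters and
layout in `RegevRoutineLayout.lean`, gadgets in `QuantumComplexity/ZoneGadgets.lean`). The
classical reversible programs of the routine over `ℕ`-indexed wires, their well-formedness and
wire bounds (so that they compile to Clifford+T words on `L + anc L` wires):

* `progW L` — the block of `W` at the offset `A0 L` (data `U ix U₂ ta wz gz Z`);
  `progV L` — the block of `V` at the offset `oV L` (data `U₂ ta wz gz Z` and the work and result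
  wires of `W`); `tV L j` — the plain-bit (`true`-code) result wire of output cell `j` of `V`;
* `progEix L` / `progET L` — erase layers: `CNOT`s from the plain-bit result wires of `V` onto `ix`
  (cells `0 … kap − 1`) and onto the mask zone `T` (cells `kap … kap + sig − 1`); `progEta L` —
  `CNOT`s from `T` onto `ta` (after the second copy of `V`, whose data `ta` is);
* `body L n k` — the program preparing register `k`: swap coin zone `k` into `ix`/`ta`; `W`; `V`;
  erase `ix`, copy the mask; `V` again (undoing the first, `clEval_cleanOps_twice`); erase `ta`
  by the mask; swap `ta[0, slotW n)` into slot `k`, the result wires of `W` into garbage zone `k`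
  and `T` into mask garbage zone `k`; increment the unary counter;
* `progInit L n` — park the input in `wz`, write the unary markers `U`, `U₂` and the bit of
  `encodeNat N` at wire `ell n − 1`; `prog L n = progInit ++ body 0 ++ … ++ body (rmax − 1)`;
* `*_wf`, `*_lt` — well-formedness and the wire bound `Wtot L` for `n ≤ L`.

## References

* O. Regev, *Quantum computation and lattice problems*, SIAM J. Comput. 33 (2004), proof of
  Lemma 3.12 (p. 14: the routine creating the registers).
* C. H. Bennett, *Logical reversibility of computation*, IBM J. Res. Develop. 17 (1973), §2.
-/

noncomputable section

namespace Literature.Algebra.EuclideanLattices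

namespace RegevRoutine

open _root_.Computability Literature.Computability.Complexity Literature.Computability.Cryptography
  Literature.Computability.QuantumComplexity Literature.Computability.QuantumComplexity.ZoneGadgets
  Turing RevSim RevClean RevMux

variable (P : Params)

/-! ### The programs -/

/-- The block of `W`, at the offset `A0`. [cite: Regev2004, Lemma 3.12 (proof, p. 14: "we add the value f(t, ā) to the last register")] -/
def progW (L : ℕ) : List (ClOp ℕ) := (cleanOps P.eW P.MW (n0W P L) []).map (ClOp.map (· + A0 P L))

/-- The block of `V`, at the offset `oV`. [cite: Bennett1973, §2 (erasing an intermediate result by recomputing it)] -/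
def progV (L : ℕ) : List (ClOp ℕ) := (cleanOps P.eV P.MV (n0V P L) []).map (ClOp.map (· + oV P L))

/-- The plain-bit result wire of output cell `j` of `V` (the `true`-code wire, `symTrue`); for
`j` beyond the read-out cells (never used semantically) the first result wire, so that the erase
layers are well formed unconditionally. [folklore] -/
def tV (L j : ℕ) : ℕ :=
  oV P L + (if j < JJ P.eV P.MV (n0V P L) then resW P.eV P.MV (n0V P L) j (CWrap.symTrue P.MV) else NN P.eV P.MV (n0V P L))

/-- `tV` on a genuine cell. [folklore] -/
theorem tV_eq {L j : ℕ} (hj : j < JJ P.eV P.MV (n0V P L)) : tV P L j = oV P L + resW P.eV P.MV (n0V P L) j (CWrap.symTrue P.MV) := by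
  unfold tV; rw [if_pos hj]

/-- Erasing `ix` from the result of `V` (cells `0 … kap − 1`). [folklore] -/
def progEix (L : ℕ) : List (ClOp ℕ) := copyZ (tV P L) (oIx P L) (kap P L)

/-- Copying the mask of `ta` (cells `kap … kap + sig − 1` of the result of `V`) onto `T`. [folklore] -/
def progET (L : ℕ) : List (ClOp ℕ) := copyZ (fun j => tV P L (kap P L + j)) (oT P L) (sig L)

/-- Erasing `ta` by the mask held in `T`. [folklore] -/
def progEta (L : ℕ) : List (ClOp ℕ) := copyZ (fun j => oT P L + j) (oTa P L) (sig L)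

/-- **The program preparing register `k`.** [cite: Regev2004, Lemma 3.12 (proof, p. 14: the routine creating one register, called once per register)] -/
def body (L n k : ℕ) : List (ClOp ℕ) :=
  swapZ (oC P L k) (oIx P L) (kap P L) ++ swapZ (oC P L k + kap P L) (oTa P L) (sig L) ++
    progW P L ++ progV P L ++ progEix P L ++ progET P L ++ progV P L ++ progEta P L ++
    swapZ (oTa P L) (oSlot n k) (slotW n) ++ swapZ (A0 P L + NNW P L) (oG P L k) (copyW P L) ++
    swapZ (oT P L) (oGT P L k) (sig L) ++ [ClOp.not (oZ P L + k)]

/-- **The initial stage**: park the input, write the unary markers and the code of `N = 2^{ℓ−1}`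
(a single `1` at wire `ℓ − 1`). [cite: Regev2004, Def. 2.1 (the DCP input; here the modulus N on the input wires of the solver)] -/
def progInit (L n : ℕ) : List (ClOp ℕ) :=
  swapZ 0 (oWz P L) L ++ notsZ (oU P L) L ++ notsZ (oV P L) L ++ [ClOp.not (ell n - 1)]

/-- **The whole classical program of the routine.** [cite: Regev2004, Lemma 3.12 (proof, p. 14)] -/
def prog (L n : ℕ) : List (ClOp ℕ) := progInit P L n ++ (List.range (rmax P L)).flatMap (body P L n)

/-! ### Well-formedness -/

section WF

variable {P}

/-- `1 ≤ JJ`. [folklore] -/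
theorem one_le_JJ (e : ℕ) (M : TM2ComputableAux Bool Bool) (n : ℕ) : 1 ≤ JJ e M n := by
  unfold JJ RevSim.dd; omega

/-- `NN < width` (there is at least one result wire). [folklore] -/
theorem NN_lt_width (e : ℕ) (M : TM2ComputableAux Bool Bool) (n : ℕ) : NN e M n < RevClean.width e M n := by
  unfold RevClean.width copyN
  have h1 := one_le_JJ e M n
  have h2 := one_le_A₁ (M := M)
  have : 1 ≤ JJ e M n * A₁ M := Nat.one_le_iff_ne_zero.2 (Nat.mul_ne_zero (by omega) (by omega))
  omega

/-- `0 < copyW` (there is at least one result wire of `W`). [folklore] -/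
theorem copyW_pos (L : ℕ) : 0 < copyW P L := by
  unfold copyW copyN
  have h1 := one_le_JJ P.eW P.MW (n0W P L)
  have h2 := one_le_A₁ (M := P.MW)
  exact Nat.pos_of_ne_zero (Nat.mul_ne_zero (by omega) (by omega))

/-- **The erase sources lie in the result zone of `V`**: `oV + NNV ≤ tV j < oT`. [folklore] -/
theorem tV_bounds (L j : ℕ) : oV P L + NNV P L ≤ tV P L j ∧ tV P L j < oT P L := by
  unfold tV oT NNV widthV
  split_ifs with hj
  · exact ⟨Nat.add_le_add_left (NN_le_resW _ _ _) _, Nat.add_lt_add_left (resW_lt_width hj _) _⟩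
  · exact ⟨le_rfl, Nat.add_lt_add_left (NN_lt_width _ _ _) _⟩

/-- `body` is well formed (`n ≤ L`, `k < rmax`). [folklore] -/
theorem body_wf {L n k : ℕ} (hn : n ≤ L) (hk : k < rmax P L) : ∀ op ∈ body P L n k, op.WF := by
  have hc := offsets_chain (P := P) L
  have hC := oC_add_cW_le (P := P) hk
  have hS := oSlot_add_slotW_le (P := P) hn hk
  have hG := gBase_le_oG (P := P) L k
  have hGT := gtBase_le_oGT (P := P) L k
  have hcw : cW P L = kap P L + sig L := rfl
  intro op hop
  simp only [body, List.mem_append, List.mem_cons, List.not_mem_nil, or_false] at hop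
  rcases hop with ((((((((((h | h) | h) | h) | h) | h) | h) | h) | h) | h) | h) | h
  · exact swapZ_wf (Or.inr (by have := cBase_le_oC (P := P) L k; omega)) op h
  · exact swapZ_wf (Or.inr (by have := cBase_le_oC (P := P) L k; omega)) op h
  · exact shift_cleanOps_wf _ _ op h
  · exact shift_cleanOps_wf _ _ op h
  · exact copyZ_wf (fun j _ => Or.inr (by have := (tV_bounds (P := P) L j).1; omega)) op h
  · exact copyZ_wf (fun j _ => Or.inl (tV_bounds (P := P) L (kap P L + j)).2) op h
  · exact shift_cleanOps_wf _ _ op h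
  · exact copyZ_wf (fun j hj => Or.inr (by omega)) op h
  · exact swapZ_wf (Or.inr (by have := ell_le_oSlot n k; unfold slotW at *; omega)) op h
  · exact swapZ_wf (Or.inl (by omega)) op h
  · exact swapZ_wf (Or.inl (by omega)) op h
  · subst h; trivial


/-- `progInit` is well formed (`n ≤ L`). [folklore] -/
theorem progInit_wf (L n : ℕ) : ∀ op ∈ progInit P L n, op.WF := by
  have hc := offsets_chain (P := P) L
  intro op hop
  simp only [progInit, List.mem_append, List.mem_cons, List.not_mem_nil, or_false] at hop
  rcases hop with ((h | h) | h) | h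
  · exact swapZ_wf (Or.inl (by omega)) op h
  · exact notsZ_wf _ _ op h
  · exact notsZ_wf _ _ op h
  · subst h; trivial

/-- `prog` is well formed (`n ≤ L`). [folklore] -/
theorem prog_wf {L n : ℕ} (hn : n ≤ L) : ∀ op ∈ prog P L n, op.WF := by
  intro op hop
  simp only [prog, List.mem_append, List.mem_flatMap, List.mem_range] at hop
  rcases hop with h | ⟨k, hk, h⟩
  · exact progInit_wf L n op h
  · exact body_wf hn hk op h

end WF

/-! ### Wire bounds -/

section LT

variable {P}

/-- Wires of `body` are below `Wtot` (`n ≤ L`, `k < rmax`). [folklore] -/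
theorem body_lt {L n k : ℕ} (hn : n ≤ L) (hk : k < rmax P L) : ∀ op ∈ body P L n k, ∀ i ∈ wiresOf op, i < Wtot P L := by
  have hc := offsets_chain (P := P) L
  have hC := oC_add_cW_le (P := P) hk
  have hS := oSlot_add_slotW_le (P := P) hn hk
  have hG := oG_add_copyW_le (P := P) hk
  have hGT := oGT_add_sig_le (P := P) hk
  have hcw : cW P L = kap P L + sig L := rfl
  have hWV : A0 P L + widthW P L ≤ oV P L + widthV P L := by
    have := NNV_le_widthV (P := P) L; omega
  have hT : oT P L = oV P L + widthV P L := rfl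
  have hsw : slotW n ≤ sig L := by unfold sig slotW; have := ell_mono hn; omega
  intro op hop
  simp only [body, List.mem_append, List.mem_cons, List.not_mem_nil, or_false] at hop
  rcases hop with ((((((((((h | h) | h) | h) | h) | h) | h) | h) | h) | h) | h) | h
  · exact swapZ_lt (by omega) (by omega) op h
  · exact swapZ_lt (by omega) (by omega) op h
  · exact shift_cleanOps_lt (by unfold widthW at *; omega) op h
  · exact shift_cleanOps_lt (by unfold widthV at *; omega) op h
  · exact copyZ_lt (by omega) (fun j _ => by have := (tV_bounds (P := P) L j).2; omega) op h
  · exact copyZ_lt (by omega) (fun j _ => by have := (tV_bounds (P := P) L (kap P L + j)).2; omega) op h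
  · exact shift_cleanOps_lt (by unfold widthV at *; omega) op h
  · exact copyZ_lt (by omega) (fun j hj => by omega) op h
  · exact swapZ_lt (by omega) (by omega) op h
  · exact swapZ_lt (by omega) (by omega) op h
  · exact swapZ_lt (by omega) (by omega) op h
  · subst h
    intro i hi
    simp [wiresOf, ClOp.target, ClOp.controls] at hi
    have : zet P L = rmax P L + 1 := rfl
    omega

/-- Wires of `progInit` are below `Wtot` (`1 ≤ n ≤ L`). [folklore] -/
theorem progInit_lt {L n : ℕ} (hn : n ≤ L) : ∀ op ∈ progInit P L n, ∀ i ∈ wiresOf op, i < Wtot P L := by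
  have hc := offsets_chain (P := P) L
  have hs : sig L = ell L + 1 := rfl
  have he : ell n ≤ ell L := ell_mono hn
  intro op hop
  simp only [progInit, List.mem_append, List.mem_cons, List.not_mem_nil, or_false] at hop
  rcases hop with ((h | h) | h) | h
  · exact swapZ_lt (by omega) (by omega) op h
  · exact notsZ_lt (by omega) op h
  · exact notsZ_lt (by omega) op h
  · subst h
    intro i hi
    simp [wiresOf, ClOp.target, ClOp.controls] at hi
    have : ell L ≤ bS P L := by unfold bS; omega
    omega

/-- Wires of `prog` are below `Wtot` (`n ≤ L`). [folklore] -/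
theorem prog_lt {L n : ℕ} (hn : n ≤ L) : ∀ op ∈ prog P L n, ∀ i ∈ wiresOf op, i < Wtot P L := by
  intro op hop
  simp only [prog, List.mem_append, List.mem_flatMap, List.mem_range] at hop
  rcases hop with h | ⟨k, hk, h⟩
  · exact progInit_lt hn op h
  · exact body_lt hn hk op h

/-- Wires of `prog` are below `L + anc L`. [folklore] -/
theorem prog_lt' {L n : ℕ} (hn : n ≤ L) : ∀ op ∈ prog P L n, ∀ i ∈ wiresOf op, i < L + anc P L := by
  rw [add_anc]; exact prog_lt hn

end LT


/-- The slots at dimension `n ≤ L` end inside the solver zone: `ell n + rmax · slotW n ≤ bS`. [folklore] -/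
theorem slots_end_le_bS {P : Params} {L n : ℕ} (hn : n ≤ L) : ell n + rmax P L * slotW n ≤ bS P L := by
  unfold bS
  have h1 : ell n ≤ ell L := ell_mono hn
  have h2 : slotW n ≤ slotW L := by unfold slotW; omega
  have h3 : rmax P L * slotW n ≤ rmax P L * slotW L := Nat.mul_le_mul_left _ h2
  omega

/-! ### Zone-wise states and their wire assignments -/

section State

variable {P}

/-- **A zone-wise description of a wire assignment** of the routine on inputs of length `L` at
dimension `n`: the content of every zone of the layout as its own function of the local index
(slots, coin, garbage and mask-garbage zones also by their number), the parked input as a list,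
the unary counter as a number, and the wires from `Wtot` on by their absolute index. [folklore] -/
structure St where
  /-- `[0, ell n)` -/
  pre : ℕ → Bool
  /-- slot `j`, local index `< slotW n` -/
  slot : ℕ → ℕ → Bool
  /-- `ix` -/
  ix : ℕ → Bool
  /-- `ta` -/
  ta : ℕ → Bool
  /-- the parked input on `wz` -/
  x : List Bool
  /-- `gz` -/
  g : ℕ → Bool
  /-- the unary counter on `Z` -/
  zc : ℕ
  /-- work wires of `W` -/
  wwork : ℕ → Bool
  /-- result wires of `W` -/
  wres : ℕ → Bool
  /-- work wires of `V` -/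
  vwork : ℕ → Bool
  /-- result wires of `V` -/
  vres : ℕ → Bool
  /-- the mask zone `T` -/
  tm : ℕ → Bool
  /-- coin zone `j`, local index `< cW` -/
  cz : ℕ → ℕ → Bool
  /-- garbage zone `j`, local index `< copyW` -/
  gz : ℕ → ℕ → Bool
  /-- mask garbage zone `j`, local index `< sig` -/
  gt : ℕ → ℕ → Bool
  /-- wires from `Wtot` on (absolute index) -/
  rest : ℕ → Bool

/-- **The wire assignment described by a zone-wise state.** [folklore] -/
def toWires (P : Params) (L n : ℕ) (s : St) : ℕ → Bool := fun i =>
  if i < ell n then s.pre i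
  else if i < ell n + rmax P L * slotW n then s.slot ((i - ell n) / slotW n) ((i - ell n) % slotW n)
  else if i < A0 P L then false
  else if i < oIx P L then decide (i < oU P L + L)
  else if i < oV P L then s.ix (i - oIx P L)
  else if i < oTa P L then decide (i < oV P L + L)
  else if i < oWz P L then s.ta (i - oTa P L)
  else if i < oGz P L then s.x.getD (i - oWz P L) false
  else if i < oZ P L then s.g (i - oGz P L)
  else if i < A0 P L + n0W P L then decide (i - oZ P L < s.zc)
  else if i < A0 P L + NNW P L then s.wwork (i - (A0 P L + n0W P L))
  else if i < A0 P L + widthW P L then s.wres (i - (A0 P L + NNW P L))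
  else if i < oV P L + NNV P L then s.vwork (i - (oV P L + n0V P L))
  else if i < oT P L then s.vres (i - (oV P L + NNV P L))
  else if i < cBase P L then s.tm (i - oT P L)
  else if i < gBase P L then s.cz ((i - cBase P L) / cW P L) ((i - cBase P L) % cW P L)
  else if i < gtBase P L then s.gz ((i - gBase P L) / copyW P L) ((i - gBase P L) % copyW P L)
  else if i < Wtot P L then s.gt ((i - gtBase P L) / sig L) ((i - gtBase P L) % sig L)
  else s.rest i

/-- Division with remainder inside a family of zones of width `w`: the wire `base + k w + t`,
`t < w`, has zone number `k` and local index `t`. [folklore] -/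
theorem zone_divMod {base w k t i : ℕ} (ht : t < w) (hi : i = base + k * w + t) :
    (i - base) / w = k ∧ (i - base) % w = t := by
  subst hi
  have hw : 0 < w := by omega
  rw [show base + k * w + t - base = t + k * w by omega, Nat.add_mul_div_right _ _ hw, Nat.div_eq_of_lt ht,
    Nat.zero_add, Nat.add_mul_mod_self_right, Nat.mod_eq_of_lt ht]
  exact ⟨rfl, rfl⟩

/-- Conversely, a wire of the family of zones lies in the zone of its quotient at its remainder. [folklore] -/
theorem zone_eq_divMod {base w i : ℕ} (hw : 0 < w) (hi : base ≤ i) :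
    i = base + (i - base) / w * w + (i - base) % w ∧ (i - base) % w < w := by
  have := Nat.div_add_mod' (i - base) w
  exact ⟨by omega, Nat.mod_lt _ hw⟩

end State


/-! ### Reading off the zones of a zone-wise state -/

section Locality

variable {P} {L n : ℕ} (s : St) {i : ℕ}

/-- Reading the zone `pre`. [folklore] -/
theorem toWires_pre (hi : i < ell n) : toWires P L n s i = s.pre i := by
  have hc := offsets_chain (P := P) L
  unfold toWires
  rw [if_pos (by omega)]

/-- Reading the zone `slot`. [folklore] -/
theorem toWires_slot (hn : n ≤ L) {j t : ℕ} (hj : j < rmax P L) (ht : t < slotW n) (hi : i = ell n + j * slotW n + t) : toWires P L n s i = s.slot j t := by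
  have hc := offsets_chain (P := P) L
  have hsl := slots_end_le_bS (P := P) hn
  have hm : (j + 1) * slotW n ≤ rmax P L * slotW n := Nat.mul_le_mul_right _ hj
  rw [Nat.add_mul, Nat.one_mul] at hm
  have hdm := zone_divMod (base := ell n) (w := slotW n) (k := j) (t := t) (i := i) ht hi
  unfold toWires
  rw [if_neg (by omega)]
  rw [if_pos (by omega)]
  rw [hdm.1, hdm.2]

/-- Reading the zone `pad`. [folklore] -/
theorem toWires_pad (hn : n ≤ L) (h1 : ell n + rmax P L * slotW n ≤ i) (h2 : i < A0 P L) : toWires P L n s i = false := by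
  have hc := offsets_chain (P := P) L
  have hsl := slots_end_le_bS (P := P) hn
  unfold toWires
  rw [if_neg (by omega)]
  rw [if_neg (by omega)]
  rw [if_pos (by omega)]

/-- Reading the zone `U`. [folklore] -/
theorem toWires_U (hn : n ≤ L) (h1 : A0 P L ≤ i) (h2 : i < oIx P L) : toWires P L n s i = decide (i < oU P L + L) := by
  have hc := offsets_chain (P := P) L
  have hsl := slots_end_le_bS (P := P) hn
  unfold toWires
  rw [if_neg (by omega)]
  rw [if_neg (by omega)]
  rw [if_neg (by omega)]
  rw [if_pos (by omega)]

/-- Reading the zone `ix`. [folklore] -/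
theorem toWires_ix (hn : n ≤ L) (h1 : oIx P L ≤ i) (h2 : i < oV P L) : toWires P L n s i = s.ix (i - oIx P L) := by
  have hc := offsets_chain (P := P) L
  have hsl := slots_end_le_bS (P := P) hn
  unfold toWires
  rw [if_neg (by omega)]
  rw [if_neg (by omega)]
  rw [if_neg (by omega)]
  rw [if_neg (by omega)]
  rw [if_pos (by omega)]

/-- Reading the zone `U2`. [folklore] -/
theorem toWires_U2 (hn : n ≤ L) (h1 : oV P L ≤ i) (h2 : i < oTa P L) : toWires P L n s i = decide (i < oV P L + L) := by
  have hc := offsets_chain (P := P) L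
  have hsl := slots_end_le_bS (P := P) hn
  unfold toWires
  rw [if_neg (by omega)]
  rw [if_neg (by omega)]
  rw [if_neg (by omega)]
  rw [if_neg (by omega)]
  rw [if_neg (by omega)]
  rw [if_pos (by omega)]

/-- Reading the zone `ta`. [folklore] -/
theorem toWires_ta (hn : n ≤ L) (h1 : oTa P L ≤ i) (h2 : i < oWz P L) : toWires P L n s i = s.ta (i - oTa P L) := by
  have hc := offsets_chain (P := P) L
  have hsl := slots_end_le_bS (P := P) hn
  unfold toWires
  rw [if_neg (by omega)]
  rw [if_neg (by omega)]
  rw [if_neg (by omega)]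
  rw [if_neg (by omega)]
  rw [if_neg (by omega)]
  rw [if_neg (by omega)]
  rw [if_pos (by omega)]

/-- Reading the zone `wz`. [folklore] -/
theorem toWires_wz (hn : n ≤ L) (h1 : oWz P L ≤ i) (h2 : i < oGz P L) : toWires P L n s i = s.x.getD (i - oWz P L) false := by
  have hc := offsets_chain (P := P) L
  have hsl := slots_end_le_bS (P := P) hn
  unfold toWires
  rw [if_neg (by omega)]
  rw [if_neg (by omega)]
  rw [if_neg (by omega)]
  rw [if_neg (by omega)]
  rw [if_neg (by omega)]
  rw [if_neg (by omega)]
  rw [if_neg (by omega)]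
  rw [if_pos (by omega)]

/-- Reading the zone `gz0`. [folklore] -/
theorem toWires_gz0 (hn : n ≤ L) (h1 : oGz P L ≤ i) (h2 : i < oZ P L) : toWires P L n s i = s.g (i - oGz P L) := by
  have hc := offsets_chain (P := P) L
  have hsl := slots_end_le_bS (P := P) hn
  unfold toWires
  rw [if_neg (by omega)]
  rw [if_neg (by omega)]
  rw [if_neg (by omega)]
  rw [if_neg (by omega)]
  rw [if_neg (by omega)]
  rw [if_neg (by omega)]
  rw [if_neg (by omega)]
  rw [if_neg (by omega)]
  rw [if_pos (by omega)]

/-- Reading the zone `Z`. [folklore] -/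
theorem toWires_Z (hn : n ≤ L) (h1 : oZ P L ≤ i) (h2 : i < A0 P L + n0W P L) : toWires P L n s i = decide (i - oZ P L < s.zc) := by
  have hc := offsets_chain (P := P) L
  have hsl := slots_end_le_bS (P := P) hn
  unfold toWires
  rw [if_neg (by omega)]
  rw [if_neg (by omega)]
  rw [if_neg (by omega)]
  rw [if_neg (by omega)]
  rw [if_neg (by omega)]
  rw [if_neg (by omega)]
  rw [if_neg (by omega)]
  rw [if_neg (by omega)]
  rw [if_neg (by omega)]
  rw [if_pos (by omega)]

/-- Reading the zone `wwork`. [folklore] -/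
theorem toWires_wwork (hn : n ≤ L) (h1 : A0 P L + n0W P L ≤ i) (h2 : i < A0 P L + NNW P L) : toWires P L n s i = s.wwork (i - (A0 P L + n0W P L)) := by
  have hc := offsets_chain (P := P) L
  have hsl := slots_end_le_bS (P := P) hn
  unfold toWires
  rw [if_neg (by omega)]
  rw [if_neg (by omega)]
  rw [if_neg (by omega)]
  rw [if_neg (by omega)]
  rw [if_neg (by omega)]
  rw [if_neg (by omega)]
  rw [if_neg (by omega)]
  rw [if_neg (by omega)]
  rw [if_neg (by omega)]
  rw [if_neg (by omega)]
  rw [if_pos (by omega)]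

/-- Reading the zone `wres`. [folklore] -/
theorem toWires_wres (hn : n ≤ L) (h1 : A0 P L + NNW P L ≤ i) (h2 : i < A0 P L + widthW P L) : toWires P L n s i = s.wres (i - (A0 P L + NNW P L)) := by
  have hc := offsets_chain (P := P) L
  have hsl := slots_end_le_bS (P := P) hn
  unfold toWires
  rw [if_neg (by omega)]
  rw [if_neg (by omega)]
  rw [if_neg (by omega)]
  rw [if_neg (by omega)]
  rw [if_neg (by omega)]
  rw [if_neg (by omega)]
  rw [if_neg (by omega)]
  rw [if_neg (by omega)]
  rw [if_neg (by omega)]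
  rw [if_neg (by omega)]
  rw [if_neg (by omega)]
  rw [if_pos (by omega)]

/-- Reading the zone `vwork`. [folklore] -/
theorem toWires_vwork (hn : n ≤ L) (h1 : A0 P L + widthW P L ≤ i) (h2 : i < oV P L + NNV P L) : toWires P L n s i = s.vwork (i - (oV P L + n0V P L)) := by
  have hc := offsets_chain (P := P) L
  have hsl := slots_end_le_bS (P := P) hn
  unfold toWires
  rw [if_neg (by omega)]
  rw [if_neg (by omega)]
  rw [if_neg (by omega)]
  rw [if_neg (by omega)]
  rw [if_neg (by omega)]
  rw [if_neg (by omega)]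
  rw [if_neg (by omega)]
  rw [if_neg (by omega)]
  rw [if_neg (by omega)]
  rw [if_neg (by omega)]
  rw [if_neg (by omega)]
  rw [if_neg (by omega)]
  rw [if_pos (by omega)]

/-- Reading the zone `vres`. [folklore] -/
theorem toWires_vres (hn : n ≤ L) (h1 : oV P L + NNV P L ≤ i) (h2 : i < oT P L) : toWires P L n s i = s.vres (i - (oV P L + NNV P L)) := by
  have hc := offsets_chain (P := P) L
  have hsl := slots_end_le_bS (P := P) hn
  unfold toWires
  rw [if_neg (by omega)]
  rw [if_neg (by omega)]
  rw [if_neg (by omega)]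
  rw [if_neg (by omega)]
  rw [if_neg (by omega)]
  rw [if_neg (by omega)]
  rw [if_neg (by omega)]
  rw [if_neg (by omega)]
  rw [if_neg (by omega)]
  rw [if_neg (by omega)]
  rw [if_neg (by omega)]
  rw [if_neg (by omega)]
  rw [if_neg (by omega)]
  rw [if_pos (by omega)]

/-- Reading the zone `tm`. [folklore] -/
theorem toWires_tm (hn : n ≤ L) (h1 : oT P L ≤ i) (h2 : i < cBase P L) : toWires P L n s i = s.tm (i - oT P L) := by
  have hc := offsets_chain (P := P) L
  have hsl := slots_end_le_bS (P := P) hn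
  unfold toWires
  rw [if_neg (by omega)]
  rw [if_neg (by omega)]
  rw [if_neg (by omega)]
  rw [if_neg (by omega)]
  rw [if_neg (by omega)]
  rw [if_neg (by omega)]
  rw [if_neg (by omega)]
  rw [if_neg (by omega)]
  rw [if_neg (by omega)]
  rw [if_neg (by omega)]
  rw [if_neg (by omega)]
  rw [if_neg (by omega)]
  rw [if_neg (by omega)]
  rw [if_neg (by omega)]
  rw [if_pos (by omega)]

/-- Reading the zone `cz`. [folklore] -/
theorem toWires_cz (hn : n ≤ L) {j t : ℕ} (hj : j < rmax P L) (ht : t < cW P L) (hi : i = cBase P L + j * cW P L + t) : toWires P L n s i = s.cz j t := by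
  have hc := offsets_chain (P := P) L
  have hsl := slots_end_le_bS (P := P) hn
  have hm : (j + 1) * cW P L ≤ rmax P L * cW P L := Nat.mul_le_mul_right _ hj
  rw [Nat.add_mul, Nat.one_mul] at hm
  have hdm := zone_divMod (base := cBase P L) (w := cW P L) (k := j) (t := t) (i := i) ht hi
  unfold toWires
  rw [if_neg (by omega)]
  rw [if_neg (by omega)]
  rw [if_neg (by omega)]
  rw [if_neg (by omega)]
  rw [if_neg (by omega)]
  rw [if_neg (by omega)]
  rw [if_neg (by omega)]
  rw [if_neg (by omega)]
  rw [if_neg (by omega)]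
  rw [if_neg (by omega)]
  rw [if_neg (by omega)]
  rw [if_neg (by omega)]
  rw [if_neg (by omega)]
  rw [if_neg (by omega)]
  rw [if_neg (by omega)]
  rw [if_pos (by omega)]
  rw [hdm.1, hdm.2]

/-- Reading the zone `gzone`. [folklore] -/
theorem toWires_gzone (hn : n ≤ L) {j t : ℕ} (hj : j < rmax P L) (ht : t < copyW P L) (hi : i = gBase P L + j * copyW P L + t) : toWires P L n s i = s.gz j t := by
  have hc := offsets_chain (P := P) L
  have hsl := slots_end_le_bS (P := P) hn
  have hm : (j + 1) * copyW P L ≤ rmax P L * copyW P L := Nat.mul_le_mul_right _ hj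
  rw [Nat.add_mul, Nat.one_mul] at hm
  have hdm := zone_divMod (base := gBase P L) (w := copyW P L) (k := j) (t := t) (i := i) ht hi
  unfold toWires
  rw [if_neg (by omega)]
  rw [if_neg (by omega)]
  rw [if_neg (by omega)]
  rw [if_neg (by omega)]
  rw [if_neg (by omega)]
  rw [if_neg (by omega)]
  rw [if_neg (by omega)]
  rw [if_neg (by omega)]
  rw [if_neg (by omega)]
  rw [if_neg (by omega)]
  rw [if_neg (by omega)]
  rw [if_neg (by omega)]
  rw [if_neg (by omega)]
  rw [if_neg (by omega)]
  rw [if_neg (by omega)]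
  rw [if_neg (by omega)]
  rw [if_pos (by omega)]
  rw [hdm.1, hdm.2]

/-- Reading the zone `gt`. [folklore] -/
theorem toWires_gt (hn : n ≤ L) {j t : ℕ} (hj : j < rmax P L) (ht : t < sig L) (hi : i = gtBase P L + j * sig L + t) : toWires P L n s i = s.gt j t := by
  have hc := offsets_chain (P := P) L
  have hsl := slots_end_le_bS (P := P) hn
  have hm : (j + 1) * sig L ≤ rmax P L * sig L := Nat.mul_le_mul_right _ hj
  rw [Nat.add_mul, Nat.one_mul] at hm
  have hdm := zone_divMod (base := gtBase P L) (w := sig L) (k := j) (t := t) (i := i) ht hi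
  unfold toWires
  rw [if_neg (by omega)]
  rw [if_neg (by omega)]
  rw [if_neg (by omega)]
  rw [if_neg (by omega)]
  rw [if_neg (by omega)]
  rw [if_neg (by omega)]
  rw [if_neg (by omega)]
  rw [if_neg (by omega)]
  rw [if_neg (by omega)]
  rw [if_neg (by omega)]
  rw [if_neg (by omega)]
  rw [if_neg (by omega)]
  rw [if_neg (by omega)]
  rw [if_neg (by omega)]
  rw [if_neg (by omega)]
  rw [if_neg (by omega)]
  rw [if_neg (by omega)]
  rw [if_pos (by omega)]
  rw [hdm.1, hdm.2]

/-- Reading the zone `rest`. [folklore] -/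
theorem toWires_rest (hn : n ≤ L) (h1 : Wtot P L ≤ i) : toWires P L n s i = s.rest i := by
  have hc := offsets_chain (P := P) L
  have hsl := slots_end_le_bS (P := P) hn
  unfold toWires
  rw [if_neg (by omega)]
  rw [if_neg (by omega)]
  rw [if_neg (by omega)]
  rw [if_neg (by omega)]
  rw [if_neg (by omega)]
  rw [if_neg (by omega)]
  rw [if_neg (by omega)]
  rw [if_neg (by omega)]
  rw [if_neg (by omega)]
  rw [if_neg (by omega)]
  rw [if_neg (by omega)]
  rw [if_neg (by omega)]
  rw [if_neg (by omega)]
  rw [if_neg (by omega)]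
  rw [if_neg (by omega)]
  rw [if_neg (by omega)]
  rw [if_neg (by omega)]
  rw [if_neg (by omega)]

end Locality


/-! ### Comparing two zone-wise states wire by wire -/

section Frame

variable {P} {L n : ℕ} {i : ℕ}

/-- **Two zone-wise states have the same wire `i` if they agree on the zone of `i`** (each
hypothesis is only about the zone containing `i`; unchanged fields are discharged by `rfl`
automatically). [folklore] -/
theorem toWires_eq_of (s s' : St)
    (hpre : i < ell n → s.pre i = s'.pre i := by intros; rfl)
    (hslot : ell n ≤ i → i < ell n + rmax P L * slotW n → s.slot ((i - ell n) / slotW n) ((i - ell n) % slotW n) = s'.slot ((i - ell n) / slotW n) ((i - ell n) % slotW n) := by intros; rfl)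
    (hix : oIx P L ≤ i → i < oV P L → s.ix (i - oIx P L) = s'.ix (i - oIx P L) := by intros; rfl)
    (hta : oTa P L ≤ i → i < oWz P L → s.ta (i - oTa P L) = s'.ta (i - oTa P L) := by intros; rfl)
    (hwz : oWz P L ≤ i → i < oGz P L → s.x.getD (i - oWz P L) false = s'.x.getD (i - oWz P L) false := by intros; rfl)
    (hg : oGz P L ≤ i → i < oZ P L → s.g (i - oGz P L) = s'.g (i - oGz P L) := by intros; rfl)
    (hZ : oZ P L ≤ i → i < A0 P L + n0W P L → decide (i - oZ P L < s.zc) = decide (i - oZ P L < s'.zc) := by intros; rfl)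
    (hwwork : A0 P L + n0W P L ≤ i → i < A0 P L + NNW P L → s.wwork (i - (A0 P L + n0W P L)) = s'.wwork (i - (A0 P L + n0W P L)) := by intros; rfl)
    (hwres : A0 P L + NNW P L ≤ i → i < A0 P L + widthW P L → s.wres (i - (A0 P L + NNW P L)) = s'.wres (i - (A0 P L + NNW P L)) := by intros; rfl)
    (hvwork : A0 P L + widthW P L ≤ i → i < oV P L + NNV P L → s.vwork (i - (oV P L + n0V P L)) = s'.vwork (i - (oV P L + n0V P L)) := by intros; rfl)
    (hvres : oV P L + NNV P L ≤ i → i < oT P L → s.vres (i - (oV P L + NNV P L)) = s'.vres (i - (oV P L + NNV P L)) := by intros; rfl)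
    (htm : oT P L ≤ i → i < cBase P L → s.tm (i - oT P L) = s'.tm (i - oT P L) := by intros; rfl)
    (hcz : cBase P L ≤ i → i < gBase P L → s.cz ((i - cBase P L) / cW P L) ((i - cBase P L) % cW P L) = s'.cz ((i - cBase P L) / cW P L) ((i - cBase P L) % cW P L) := by intros; rfl)
    (hgz : gBase P L ≤ i → i < gtBase P L → s.gz ((i - gBase P L) / copyW P L) ((i - gBase P L) % copyW P L) = s'.gz ((i - gBase P L) / copyW P L) ((i - gBase P L) % copyW P L) := by intros; rfl)
    (hgt : gtBase P L ≤ i → i < Wtot P L → s.gt ((i - gtBase P L) / sig L) ((i - gtBase P L) % sig L) = s'.gt ((i - gtBase P L) / sig L) ((i - gtBase P L) % sig L) := by intros; rfl)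
    (hrest : Wtot P L ≤ i → s.rest i = s'.rest i := by intros; rfl) :
    toWires P L n s i = toWires P L n s' i := by
  unfold toWires
  refine if_ctx_congr Iff.rfl (fun h0 => hpre h0) (fun h0 => ?_)
  refine if_ctx_congr Iff.rfl (fun h1 => hslot (not_lt.1 h0) h1) (fun h1 => ?_)
  refine if_ctx_congr Iff.rfl (fun _ => rfl) (fun h2 => ?_)
  refine if_ctx_congr Iff.rfl (fun _ => rfl) (fun h3 => ?_)
  refine if_ctx_congr Iff.rfl (fun h4 => hix (not_lt.1 h3) h4) (fun h4 => ?_)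
  refine if_ctx_congr Iff.rfl (fun _ => rfl) (fun h5 => ?_)
  refine if_ctx_congr Iff.rfl (fun h6 => hta (not_lt.1 h5) h6) (fun h6 => ?_)
  refine if_ctx_congr Iff.rfl (fun h7 => hwz (not_lt.1 h6) h7) (fun h7 => ?_)
  refine if_ctx_congr Iff.rfl (fun h8 => hg (not_lt.1 h7) h8) (fun h8 => ?_)
  refine if_ctx_congr Iff.rfl (fun h9 => hZ (not_lt.1 h8) h9) (fun h9 => ?_)
  refine if_ctx_congr Iff.rfl (fun h10 => hwwork (not_lt.1 h9) h10) (fun h10 => ?_)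
  refine if_ctx_congr Iff.rfl (fun h11 => hwres (not_lt.1 h10) h11) (fun h11 => ?_)
  refine if_ctx_congr Iff.rfl (fun h12 => hvwork (not_lt.1 h11) h12) (fun h12 => ?_)
  refine if_ctx_congr Iff.rfl (fun h13 => hvres (not_lt.1 h12) h13) (fun h13 => ?_)
  refine if_ctx_congr Iff.rfl (fun h14 => htm (not_lt.1 h13) h14) (fun h14 => ?_)
  refine if_ctx_congr Iff.rfl (fun h15 => hcz (not_lt.1 h14) h15) (fun h15 => ?_)
  refine if_ctx_congr Iff.rfl (fun h16 => hgz (not_lt.1 h15) h16) (fun h16 => ?_)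
  refine if_ctx_congr Iff.rfl (fun h17 => hgt (not_lt.1 h16) h17) (fun h17 => ?_)
  exact hrest (not_lt.1 h17)

end Frame

/-! ### The data words of the two blocks -/

section Words

variable {P} {L n : ℕ}

/-- Reading a window of the wire assignment as a word. [folklore] -/
def window (w : ℕ → Bool) (S len : ℕ) : List Bool := List.ofFn fun j : Fin len => w (S + j)

/-- Length of a window word. [folklore] -/
@[simp] theorem length_window (w : ℕ → Bool) (S len : ℕ) : (window w S len).length = len := List.length_ofFn

/-- Letters of a window word. [folklore] -/
theorem getD_window (w : ℕ → Bool) (S len : ℕ) {j : ℕ} (hj : j < len) : (window w S len).getD j false = w (S + j) := by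
  rw [window, List.getD_eq_getElem _ _ (by simpa using hj), List.getElem_ofFn]

/-- **The data word of `W`**: the zones `U ix U₂ ta wz gz Z`. [cite: Regev2004, Lemma 3.12 (proof, p. 14: the data |t, ā⟩ ⊗ |η⟩ of the routine)] -/
def dW (P : Params) (L n : ℕ) (s : St) : List Bool := window (toWires P L n s) (A0 P L) (n0W P L)

/-- **The data word of `V`**: from `U₂` to the end of the block `W`. [folklore] -/
def dV (P : Params) (L n : ℕ) (s : St) : List Bool := window (toWires P L n s) (oV P L) (n0V P L)

/-- The read-out of `W` on its result wires, as a function of the local index. [folklore] -/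
def rdW (P : Params) (L n : ℕ) (s : St) : ℕ → Bool := fun t =>
  readOut P.eW P.MW (n0W P L) (P.fW (dW P L n s)) (NNW P L + t)

/-- The read-out of `V` on its result wires, as a function of the local index. [folklore] -/
def rdV (P : Params) (L n : ℕ) (s : St) : ℕ → Bool := fun t =>
  readOut P.eV P.MV (n0V P L) (P.fV (dV P L n s)) (NNV P L + t)

/-- The bit of the result of `V` driving the erase of cell `j` (the `true`-code wire of cell `j`). [folklore] -/
def eV (P : Params) (L n : ℕ) (s : St) (j : ℕ) : Bool := toWires P L n s (tV P L j)

end Words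

/-! ### The gadgets of the body on zone-wise states -/

section BodySteps

variable {P} {L n k : ℕ}

/-- **Step 1**: swapping the `ix` field of coin zone `k` into `ix`. [folklore] -/
theorem step_swapIx (hn : n ≤ L) (hk : k < rmax P L) (s : St) :
    clEval (swapZ (oC P L k) (oIx P L) (kap P L)) (toWires P L n s) =
      toWires P L n { s with ix := (fun t => s.cz k t), cz := (fun j t => if j = k ∧ t < kap P L then s.ix t else s.cz j t) } := by
  have hc := offsets_chain (P := P) L
  have hC := oC_add_cW_le (P := P) hk
  have hCb := cBase_le_oC (P := P) L k
  have hcw : cW P L = kap P L + sig L := rfl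
  have hoC : oC P L k = cBase P L + k * cW P L := rfl
  rw [clEval_swapZ (Or.inr (by omega))]
  funext i
  simp only [swapFun]
  by_cases h1 : oC P L k ≤ i ∧ i < oC P L k + kap P L
  · rw [if_pos h1, toWires_ix s hn (by omega) (by omega),
      toWires_cz _ hn hk (t := i - oC P L k) (by omega) (by omega)]
    dsimp only
    rw [if_pos ⟨rfl, by omega⟩]
    congr 1; omega
  · rw [if_neg h1]
    by_cases h2 : oIx P L ≤ i ∧ i < oIx P L + kap P L
    · rw [if_pos h2, toWires_cz s hn hk (t := i - oIx P L) (by omega) (by omega), toWires_ix _ hn (by omega) (by omega)]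
    · rw [if_neg h2]
      refine toWires_eq_of s _ (hix := fun hlo hhi => absurd ⟨hlo, by omega⟩ h2) (hcz := fun hlo hhi => ?_)
      dsimp only
      rw [if_neg]
      rintro ⟨hq, hr⟩
      have hz := zone_eq_divMod (base := cBase P L) (w := cW P L) (i := i) (by omega) hlo
      rw [hq] at hz
      exact h1 ⟨by omega, by omega⟩

/-- **Step 2**: swapping the `ta` field of coin zone `k` into `ta`. [folklore] -/
theorem step_swapTa (hn : n ≤ L) (hk : k < rmax P L) (s : St) :
    clEval (swapZ (oC P L k + kap P L) (oTa P L) (sig L)) (toWires P L n s) =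
      toWires P L n { s with ta := (fun t => s.cz k (kap P L + t)), cz := (fun j t => if j = k ∧ kap P L ≤ t ∧ t < cW P L then s.ta (t - kap P L) else s.cz j t) } := by
  have hc := offsets_chain (P := P) L
  have hC := oC_add_cW_le (P := P) hk
  have hCb := cBase_le_oC (P := P) L k
  have hcw : cW P L = kap P L + sig L := rfl
  have hoC : oC P L k = cBase P L + k * cW P L := rfl
  rw [clEval_swapZ (Or.inr (by omega))]
  funext i
  simp only [swapFun]
  by_cases h1 : oC P L k + kap P L ≤ i ∧ i < oC P L k + kap P L + sig L
  · rw [if_pos h1, toWires_ta s hn (by omega) (by omega),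
      toWires_cz _ hn hk (t := i - oC P L k) (by omega) (by omega)]
    dsimp only
    rw [if_pos ⟨rfl, by omega, by omega⟩]
    congr 1; omega
  · rw [if_neg h1]
    by_cases h2 : oTa P L ≤ i ∧ i < oTa P L + sig L
    · rw [if_pos h2, toWires_cz s hn hk (t := kap P L + (i - oTa P L)) (by omega) (by omega),
        toWires_ta _ hn (by omega) (by omega)]
    · rw [if_neg h2]
      refine toWires_eq_of s _ (hta := fun hlo hhi => absurd ⟨hlo, by omega⟩ h2) (hcz := fun hlo hhi => ?_)
      dsimp only
      rw [if_neg]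
      rintro ⟨hq, hr1, hr2⟩
      have hz := zone_eq_divMod (base := cBase P L) (w := cW P L) (i := i) (by omega) hlo
      rw [hq] at hz
      exact h1 ⟨by omega, by omega⟩

/-- **Step 3: the block `W`** writes the read-out of `fW (dW s)` on its result wires (work and
result wires of `W` must be clean). [cite: Shor1997, §3 p.8 (compute F(x) keeping x, copy, undo)] -/
theorem step_W (hn : n ≤ L) (s : St) (hw1 : s.wwork = fun _ => false) (hw2 : s.wres = fun _ => false) :
    clEval (progW P L) (toWires P L n s) = toWires P L n { s with wres := rdW P L n s } := by
  have hc := offsets_chain (P := P) L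
  have hlen : (dW P L n s).length = n0W P L := length_window _ _ _
  have hwid : RevClean.width P.eW P.MW (dW P L n s).length = widthW P L := by rw [hlen]; rfl
  have key := clEval_shift_cleanOps_local (e := P.eW) (M := P.MW) (S := A0 P L) (dW P L n s) (P.fW (dW P L n s))
    (P.hMW _) (toWires P L n s) (fun i hi => ?_)
  · rw [hwid, hlen] at key
    rw [progW, key]
    funext i
    by_cases hwin : A0 P L ≤ i ∧ i < A0 P L + widthW P L
    · rw [if_pos hwin]
      by_cases hd : i - A0 P L < n0W P L
      · rw [if_pos hd, dW, getD_window _ _ _ hd, show A0 P L + (i - A0 P L) = i by omega]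
        exact toWires_eq_of s _ (hwres := fun hlo _ => by exfalso; omega)
      · rw [if_neg hd]
        by_cases hr : i < A0 P L + NNW P L
        · rw [CWrap.readOut_of_lt_NN _ (by unfold NNW at hr; omega), toWires_wwork _ hn (by omega) hr]
          change false = s.wwork _
          rw [hw1]
        · rw [toWires_wres _ hn (by omega) hwin.2]
          change _ = rdW P L n s _
          simp only [rdW]
          congr 1; omega
    · rw [if_neg hwin]
      exact toWires_eq_of s _ (hwres := fun hlo hhi => by exfalso; exact hwin ⟨by omega, hhi⟩)
  · -- the window holds `dW 0 … 0`
    rw [hwid] at hi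
    by_cases hd : i < n0W P L
    · rw [strW, dW, getD_window _ _ _ hd]
    · rw [strW, List.getD_eq_default _ _ (by rw [hlen]; omega)]
      by_cases hr : A0 P L + i < A0 P L + NNW P L
      · rw [toWires_wwork s hn (by omega) hr, hw1]
      · rw [toWires_wres s hn (by omega) (by omega), hw2]

/-- **Step 4: the block `V`** writes the read-out of `fV (dV s)` on its result wires (work and
result wires of `V` must be clean). [cite: Bennett1973, §2 (recomputing an intermediate result in order to erase it)] -/
theorem step_V (hn : n ≤ L) (s : St) (hv1 : s.vwork = fun _ => false) (hv2 : s.vres = fun _ => false) :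
    clEval (progV P L) (toWires P L n s) = toWires P L n { s with vres := rdV P L n s } := by
  have hc := offsets_chain (P := P) L
  have hT : oT P L = oV P L + widthV P L := rfl
  have hlen : (dV P L n s).length = n0V P L := length_window _ _ _
  have hwid : RevClean.width P.eV P.MV (dV P L n s).length = widthV P L := by rw [hlen]; rfl
  have key := clEval_shift_cleanOps_local (e := P.eV) (M := P.MV) (S := oV P L) (dV P L n s) (P.fV (dV P L n s))
    (P.hMV _) (toWires P L n s) (fun i hi => ?_)
  · rw [hwid, hlen] at key
    rw [progV, key]
    funext i
    by_cases hwin : oV P L ≤ i ∧ i < oV P L + widthV P L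
    · rw [if_pos hwin]
      by_cases hd : i - oV P L < n0V P L
      · rw [if_pos hd, dV, getD_window _ _ _ hd, show oV P L + (i - oV P L) = i by omega]
        exact toWires_eq_of s _ (hvres := fun hlo _ => by exfalso; omega)
      · rw [if_neg hd]
        by_cases hr : i < oV P L + NNV P L
        · rw [CWrap.readOut_of_lt_NN _ (by unfold NNV at hr; omega), toWires_vwork _ hn (by omega) hr]
          change false = s.vwork _
          rw [hv1]
        · rw [toWires_vres _ hn (by omega) (by omega)]
          change _ = rdV P L n s _
          simp only [rdV]
          congr 1; omega
    · rw [if_neg hwin]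
      exact toWires_eq_of s _ (hvres := fun hlo hhi => by exfalso; exact hwin ⟨by omega, by omega⟩)
  · rw [hwid] at hi
    by_cases hd : i < n0V P L
    · rw [strW, dV, getD_window _ _ _ hd]
    · rw [strW, List.getD_eq_default _ _ (by rw [hlen]; omega)]
      by_cases hr : oV P L + i < oV P L + NNV P L
      · rw [toWires_vwork s hn (by omega) hr, hv1]
      · rw [toWires_vres s hn (by omega) (by omega), hv2]

/-- **Step 7: the second copy of `V` cleans its result wires** — if they hold exactly the read-out
of `fV` on the (unchanged) data. [cite: NielsenChuang2010, §3.2.5 (uncomputation)] -/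
theorem step_V_twice (hn : n ≤ L) (s : St) (hv1 : s.vwork = fun _ => false)
    (hv2 : s.vres = rdV P L n { s with vres := fun _ => false }) :
    clEval (progV P L) (toWires P L n s) = toWires P L n { s with vres := fun _ => false } := by
  set s₀ : St := { s with vres := fun _ => false } with hs₀
  have hc := offsets_chain (P := P) L
  have hT : oT P L = oV P L + widthV P L := rfl
  have hlen : (dV P L n s₀).length = n0V P L := length_window _ _ _
  have hwid : RevClean.width P.eV P.MV (dV P L n s₀).length = widthV P L := by rw [hlen]; rfl
  -- `s` is the state after the first copy of `V` on `s₀`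
  have hs : s = { s₀ with vres := rdV P L n s₀ } := by
    cases s
    simp only [hs₀] at hv2 ⊢
    rw [hv2]
  have h1 : toWires P L n s = clEval (progV P L) (toWires P L n s₀) := by
    rw [step_V hn s₀ hv1 rfl, ← hs]
  rw [h1, progV]
  have key := clEval_shift_cleanOps_twice_local (e := P.eV) (M := P.MV) (S := oV P L) (dV P L n s₀) (P.fV (dV P L n s₀))
    (P.hMV _) (toWires P L n s₀) (fun i hi => ?_)
  · rw [hlen] at key; exact key
  · rw [hwid] at hi
    by_cases hd : i < n0V P L
    · rw [strW, dV, getD_window _ _ _ hd]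
    · rw [strW, List.getD_eq_default _ _ (by rw [hlen]; omega)]
      by_cases hr : oV P L + i < oV P L + NNV P L
      · rw [toWires_vwork s₀ hn (by omega) hr]; exact congrFun hv1 _
      · rw [toWires_vres s₀ hn (by omega) (by omega)]

/-- The erase bit of cell `j` is a result wire of `V`. [folklore] -/
theorem eV_eq (hn : n ≤ L) (s : St) (j : ℕ) : eV P L n s j = s.vres (tV P L j - (oV P L + NNV P L)) := by
  have h := tV_bounds (P := P) L j
  exact toWires_vres s hn h.1 h.2

/-- **Step 5: erasing `ix`** by the first `kap` plain result bits of `V`. [folklore] -/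
theorem step_Eix (hn : n ≤ L) (s : St) :
    clEval (progEix P L) (toWires P L n s) = toWires P L n { s with ix := fun t => s.ix t ^^ eV P L n s t } := by
  have hc := offsets_chain (P := P) L
  rw [progEix, clEval_copyZ (fun j _ => Or.inr (by have := (tV_bounds (P := P) L j).1; omega))]
  funext i
  by_cases h1 : oIx P L ≤ i ∧ i < oIx P L + kap P L
  · rw [if_pos h1, toWires_ix s hn h1.1 (by omega), toWires_ix _ hn h1.1 (by omega)]
    rfl
  · rw [if_neg h1]
    exact toWires_eq_of s _ (hix := fun hlo hhi => absurd ⟨hlo, by omega⟩ h1)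

/-- **Step 6: copying the mask** (cells `kap … kap + sig − 1`) onto `T`. [folklore] -/
theorem step_ET (hn : n ≤ L) (s : St) :
    clEval (progET P L) (toWires P L n s) = toWires P L n { s with tm := fun t => s.tm t ^^ eV P L n s (kap P L + t) } := by
  have hc := offsets_chain (P := P) L
  rw [progET, clEval_copyZ (fun j _ => Or.inl (tV_bounds (P := P) L (kap P L + j)).2)]
  funext i
  by_cases h1 : oT P L ≤ i ∧ i < oT P L + sig L
  · rw [if_pos h1, toWires_tm s hn h1.1 (by omega), toWires_tm _ hn h1.1 (by omega)]
    rfl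
  · rw [if_neg h1]
    exact toWires_eq_of s _ (htm := fun hlo hhi => absurd ⟨hlo, by omega⟩ h1)

/-- **Step 8: erasing `ta` by the mask.** [folklore] -/
theorem step_Eta (hn : n ≤ L) (s : St) :
    clEval (progEta P L) (toWires P L n s) = toWires P L n { s with ta := fun t => s.ta t ^^ s.tm t } := by
  have hc := offsets_chain (P := P) L
  rw [progEta, clEval_copyZ (fun j hj => Or.inr (by omega))]
  funext i
  by_cases h1 : oTa P L ≤ i ∧ i < oTa P L + sig L
  · rw [if_pos h1, toWires_ta s hn h1.1 (by omega), toWires_ta _ hn h1.1 (by omega),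
      toWires_tm s hn (by omega) (by omega)]
    change (s.ta (i - oTa P L) ^^ s.tm (oT P L + (i - oTa P L) - oT P L)) = (s.ta (i - oTa P L) ^^ s.tm (i - oTa P L))
    congr 2; omega
  · rw [if_neg h1]
    exact toWires_eq_of s _ (hta := fun hlo hhi => absurd ⟨hlo, by omega⟩ h1)

/-- **Step 9: routing `ta[0, slotW n)` into slot `k`.** [cite: Regev2004, Def. 2.1 (the registers of the DCP input)] -/
theorem step_slot (hn : n ≤ L) (hk : k < rmax P L) (s : St) :
    clEval (swapZ (oTa P L) (oSlot n k) (slotW n)) (toWires P L n s) =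
      toWires P L n { s with ta := (fun t => if t < slotW n then s.slot k t else s.ta t), slot := (fun j t => if j = k ∧ t < slotW n then s.ta t else s.slot j t) } := by
  have hc := offsets_chain (P := P) L
  have hS := oSlot_add_slotW_le (P := P) hn hk
  have hsl := slots_end_le_bS (P := P) hn
  have hsw : slotW n ≤ sig L := by unfold sig slotW; have := ell_mono hn; omega
  have hoS : oSlot n k = ell n + k * slotW n := rfl
  have hm : (k + 1) * slotW n ≤ rmax P L * slotW n := Nat.mul_le_mul_right _ hk
  rw [Nat.add_mul, Nat.one_mul] at hm
  rw [clEval_swapZ (Or.inr (by omega))]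
  funext i
  simp only [swapFun]
  by_cases h1 : oTa P L ≤ i ∧ i < oTa P L + slotW n
  · rw [if_pos h1, toWires_slot s hn hk (t := i - oTa P L) (by omega) (by omega), toWires_ta _ hn (by omega) (by omega)]
    dsimp only
    rw [if_pos (by omega)]
  · rw [if_neg h1]
    by_cases h2 : oSlot n k ≤ i ∧ i < oSlot n k + slotW n
    · rw [if_pos h2, toWires_ta s hn (by omega) (by omega), toWires_slot _ hn hk (t := i - oSlot n k) (by omega) (by omega)]
      dsimp only
      rw [if_pos ⟨rfl, by omega⟩]
      congr 1; omega
    · rw [if_neg h2]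
      refine toWires_eq_of s _ (hta := fun hlo hhi => ?_) (hslot := fun hlo hhi => ?_)
      · dsimp only
        rw [if_neg]
        rintro ⟨hq, hr⟩
        have hz := zone_eq_divMod (base := ell n) (w := slotW n) (i := i) (by unfold slotW; omega) hlo
        rw [hq] at hz
        exact h2 ⟨by omega, by omega⟩
      · dsimp only
        rw [if_neg]
        intro ht
        exact h1 ⟨hlo, by omega⟩

/-- **Step 10: moving the result wires of `W` into garbage zone `k`.** [folklore] -/
theorem step_garb (hn : n ≤ L) (hk : k < rmax P L) (s : St) :
    clEval (swapZ (A0 P L + NNW P L) (oG P L k) (copyW P L)) (toWires P L n s) =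
      toWires P L n { s with wres := (fun t => s.gz k t), gz := (fun j t => if j = k then s.wres t else s.gz j t) } := by
  have hc := offsets_chain (P := P) L
  have hG := oG_add_copyW_le (P := P) hk
  have hGb := gBase_le_oG (P := P) L k
  have hoG : oG P L k = gBase P L + k * copyW P L := rfl
  rw [clEval_swapZ (Or.inl (by omega))]
  funext i
  simp only [swapFun]
  by_cases h1 : A0 P L + NNW P L ≤ i ∧ i < A0 P L + NNW P L + copyW P L
  · rw [if_pos h1, toWires_gzone s hn hk (t := i - (A0 P L + NNW P L)) (by omega) (by omega),
      toWires_wres _ hn (by omega) (by omega)]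
  · rw [if_neg h1]
    by_cases h2 : oG P L k ≤ i ∧ i < oG P L k + copyW P L
    · rw [if_pos h2, toWires_wres s hn (by omega) (by omega), toWires_gzone _ hn hk (t := i - oG P L k) (by omega) (by omega)]
      dsimp only
      rw [if_pos rfl]
      congr 1; omega
    · rw [if_neg h2]
      refine toWires_eq_of s _ (hwres := fun hlo hhi => absurd ⟨hlo, by omega⟩ h1) (hgz := fun hlo hhi => ?_)
      dsimp only
      rw [if_neg]
      intro hq
      have hz := zone_eq_divMod (base := gBase P L) (w := copyW P L) (i := i) (copyW_pos (P := P) L) hlo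
      rw [hq] at hz
      exact h2 ⟨by omega, by omega⟩

/-- **Step 11: moving the mask into mask garbage zone `k`.** [folklore] -/
theorem step_maskGarb (hn : n ≤ L) (hk : k < rmax P L) (s : St) :
    clEval (swapZ (oT P L) (oGT P L k) (sig L)) (toWires P L n s) =
      toWires P L n { s with tm := (fun t => s.gt k t), gt := (fun j t => if j = k then s.tm t else s.gt j t) } := by
  have hc := offsets_chain (P := P) L
  have hG := oGT_add_sig_le (P := P) hk
  have hGb := gtBase_le_oGT (P := P) L k
  have hoG : oGT P L k = gtBase P L + k * sig L := rfl
  rw [clEval_swapZ (Or.inl (by omega))]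
  funext i
  simp only [swapFun]
  by_cases h1 : oT P L ≤ i ∧ i < oT P L + sig L
  · rw [if_pos h1, toWires_gt s hn hk (t := i - oT P L) (by omega) (by omega), toWires_tm _ hn (by omega) (by omega)]
  · rw [if_neg h1]
    by_cases h2 : oGT P L k ≤ i ∧ i < oGT P L k + sig L
    · rw [if_pos h2, toWires_tm s hn (by omega) (by omega), toWires_gt _ hn hk (t := i - oGT P L k) (by omega) (by omega)]
      dsimp only
      rw [if_pos rfl]
      congr 1; omega
    · rw [if_neg h2]
      refine toWires_eq_of s _ (htm := fun hlo hhi => absurd ⟨hlo, by omega⟩ h1) (hgt := fun hlo hhi => ?_)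
      dsimp only
      rw [if_neg]
      intro hq
      have hz := zone_eq_divMod (base := gtBase P L) (w := sig L) (i := i) (by unfold sig slotW; omega) hlo
      rw [hq] at hz
      exact h2 ⟨by omega, by omega⟩

/-- **Step 12: incrementing the unary counter** (`NOT` at `oZ + k` when the counter reads `k`). [folklore] -/
theorem step_count (hn : n ≤ L) (hk : k < rmax P L) (s : St) (hzc : s.zc = k) :
    clEval [ClOp.not (oZ P L + k)] (toWires P L n s) = toWires P L n { s with zc := k + 1 } := by
  have hc := offsets_chain (P := P) L
  have hz : zet P L = rmax P L + 1 := rfl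
  funext i
  rw [clEval_cons, clEval_nil, ClOp.eval_not]
  by_cases hi : i = oZ P L + k
  · subst hi
    rw [Function.update_self, toWires_Z s hn (by omega) (by omega), toWires_Z _ hn (by omega) (by omega), hzc]
    simp
  · rw [Function.update_of_ne hi]
    refine toWires_eq_of s _ (hZ := fun hlo hhi => ?_)
    dsimp only
    rw [hzc]
    by_cases h : i - oZ P L < k
    · simp [h, show i - oZ P L < k + 1 by omega]
    · simp [h, show ¬ (i - oZ P L < k + 1) by omega]

end BodySteps


/-! ### The body as a function of zone-wise states -/

section Body

/-- Step 1 on states. [folklore] -/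
def st1 (L k : ℕ) (s : St) : St :=
  { s with ix := (fun t => s.cz k t), cz := (fun j t => if j = k ∧ t < kap P L then s.ix t else s.cz j t) }
/-- Step 2 on states. [folklore] -/
def st2 (L k : ℕ) (s : St) : St :=
  { s with ta := (fun t => s.cz k (kap P L + t)), cz := (fun j t => if j = k ∧ kap P L ≤ t ∧ t < cW P L then s.ta (t - kap P L) else s.cz j t) }
/-- Step 3 (`W`) on states. [folklore] -/
def stW (L n : ℕ) (s : St) : St := { s with wres := rdW P L n s }
/-- Step 4 (`V`) on states. [folklore] -/
def stV (L n : ℕ) (s : St) : St := { s with vres := rdV P L n s }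
/-- Step 5 (erase `ix`) on states. [folklore] -/
def stEix (L n : ℕ) (s : St) : St := { s with ix := fun t => s.ix t ^^ eV P L n s t }
/-- Step 6 (copy the mask) on states. [folklore] -/
def stET (L n : ℕ) (s : St) : St := { s with tm := fun t => s.tm t ^^ eV P L n s (kap P L + t) }
/-- Step 7 (second `V`) on states. [folklore] -/
def stV0 (s : St) : St := { s with vres := fun _ => false }
/-- Step 8 (erase `ta` by the mask) on states. [folklore] -/
def stEta (s : St) : St := { s with ta := fun t => s.ta t ^^ s.tm t }
/-- Step 9 (route into slot `k`) on states. [folklore] -/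
def stSlot (n k : ℕ) (s : St) : St :=
  { s with ta := (fun t => if t < slotW n then s.slot k t else s.ta t), slot := (fun j t => if j = k ∧ t < slotW n then s.ta t else s.slot j t) }
/-- Step 10 (garbage) on states. [folklore] -/
def stGarb (k : ℕ) (s : St) : St :=
  { s with wres := (fun t => s.gz k t), gz := (fun j t => if j = k then s.wres t else s.gz j t) }
/-- Step 11 (mask garbage) on states. [folklore] -/
def stMask (k : ℕ) (s : St) : St :=
  { s with tm := (fun t => s.gt k t), gt := (fun j t => if j = k then s.tm t else s.gt j t) }
/-- Step 12 (counter) on states. [folklore] -/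
def stCount (k : ℕ) (s : St) : St := { s with zc := k + 1 }

/-- The state after the compute stages of the body (coins in, `W`, `V`, erase `ix`, mask). [folklore] -/
def midSt (L n k : ℕ) (s : St) : St := stET P L n (stEix P L n (stV P L n (stW P L n (st2 P L k (st1 P L k s)))))

/-- **The body on zone-wise states.** [cite: Regev2004, Lemma 3.12 (proof, p. 14: the routine creating one register)] -/
def bodySt (L n k : ℕ) (s : St) : St :=
  stCount k (stMask k (stGarb k (stSlot n k (stEta (stV0 (midSt P L n k s))))))

variable {P}

/-- The data word of `V` depends only on the zones it reads. [folklore] -/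
theorem dV_congr {L n : ℕ} (hn : n ≤ L) {s s' : St} (hta : s.ta = s'.ta) (hx : s.x = s'.x) (hg : s.g = s'.g) (hzc : s.zc = s'.zc)
    (hww : s.wwork = s'.wwork) (hwr : s.wres = s'.wres) : dV P L n s = dV P L n s' := by
  have hc := offsets_chain (P := P) L
  unfold dV window
  congr 1
  funext j
  have hj := j.isLt
  exact toWires_eq_of s s' (hta := fun _ _ => by rw [hta]) (hwz := fun _ _ => by rw [hx]) (hg := fun _ _ => by rw [hg])
    (hZ := fun _ _ => by rw [hzc]) (hwwork := fun _ _ => by rw [hww]) (hwres := fun _ _ => by rw [hwr])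
    (hix := fun _ hhi => by exfalso; omega) (hvwork := fun hlo _ => by exfalso; omega)
    (hvres := fun hlo _ => by exfalso; omega) (htm := fun hlo _ => by exfalso; omega)
    (hcz := fun hlo _ => by exfalso; omega) (hgz := fun hlo _ => by exfalso; omega)
    (hgt := fun hlo _ => by exfalso; omega) (hrest := fun hlo => by exfalso; omega)
    (hpre := fun hhi => by exfalso; have := slots_end_le_bS (P := P) hn; omega)
    (hslot := fun _ hhi => by exfalso; have := slots_end_le_bS (P := P) hn; omega)

/-- Cleanliness of the block zones of a state: the work and result wires of both blocks are `0`. [folklore] -/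
structure Clean (s : St) : Prop where
  wwork : s.wwork = fun _ => false
  wres : s.wres = fun _ => false
  vwork : s.vwork = fun _ => false
  vres : s.vres = fun _ => false

/-- **Semantics of the body on register `k`**: from a clean state whose counter reads `k`, the
program `body L n k` leads to `bodySt k`. [cite: Regev2004, Lemma 3.12 (proof, p. 14)] -/
theorem body_sem {L n k : ℕ} (hn : n ≤ L) (hk : k < rmax P L) (s : St) (h : Clean s) (hzc : s.zc = k) :
    clEval (body P L n k) (toWires P L n s) = toWires P L n (bodySt P L n k s) := by
  set s2 := st2 P L k (st1 P L k s) with hs2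
  set s3 := stW P L n s2 with hs3
  set s6 := midSt P L n k s with hs6
  have e1 : clEval (swapZ (oC P L k) (oIx P L) (kap P L)) (toWires P L n s) = toWires P L n (st1 P L k s) := step_swapIx hn hk s
  have e2 : clEval (swapZ (oC P L k + kap P L) (oTa P L) (sig L)) (toWires P L n (st1 P L k s)) = toWires P L n s2 :=
    step_swapTa hn hk _
  have e3 : clEval (progW P L) (toWires P L n s2) = toWires P L n s3 := step_W hn _ h.wwork h.wres
  have e4 : clEval (progV P L) (toWires P L n s3) = toWires P L n (stV P L n s3) := step_V hn _ h.vwork h.vres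
  have e5 : clEval (progEix P L) (toWires P L n (stV P L n s3)) = toWires P L n (stEix P L n (stV P L n s3)) := step_Eix hn _
  have e6 : clEval (progET P L) (toWires P L n (stEix P L n (stV P L n s3))) = toWires P L n s6 := step_ET hn _
  -- the second `V`: its data did not change since the first
  have hrd : rdV P L n s3 = rdV P L n { s6 with vres := fun _ => false } := by
    unfold rdV
    rw [dV_congr hn (s := s3) (s' := { s6 with vres := fun _ => false }) rfl rfl rfl rfl rfl rfl]
  have e7 : clEval (progV P L) (toWires P L n s6) = toWires P L n (stV0 s6) :=
    step_V_twice hn s6 h.vwork (by rw [← hrd]; rfl)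
  have e8 : clEval (progEta P L) (toWires P L n (stV0 s6)) = toWires P L n (stEta (stV0 s6)) := step_Eta hn _
  have e9 : clEval (swapZ (oTa P L) (oSlot n k) (slotW n)) (toWires P L n (stEta (stV0 s6))) =
      toWires P L n (stSlot n k (stEta (stV0 s6))) := step_slot hn hk _
  have e10 : clEval (swapZ (A0 P L + NNW P L) (oG P L k) (copyW P L)) (toWires P L n (stSlot n k (stEta (stV0 s6)))) =
      toWires P L n (stGarb k (stSlot n k (stEta (stV0 s6)))) := step_garb hn hk _
  have e11 : clEval (swapZ (oT P L) (oGT P L k) (sig L)) (toWires P L n (stGarb k (stSlot n k (stEta (stV0 s6))))) =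
      toWires P L n (stMask k (stGarb k (stSlot n k (stEta (stV0 s6))))) := step_maskGarb hn hk _
  have e12 : clEval [ClOp.not (oZ P L + k)] (toWires P L n (stMask k (stGarb k (stSlot n k (stEta (stV0 s6)))))) =
      toWires P L n (bodySt P L n k s) := step_count hn hk _ hzc
  simp only [body, clEval_append]
  rw [e1, e2, e3, e4, e5, e6, e7, e8, e9, e10, e11, e12]

end Body


end RegevRoutine

end Literature.Algebra.EuclideanLattices

end
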